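import Literature.NumberTheory.Transcendental.ExpDominantSolvability
import Literature.NumberTheory.Transcendental.ExpDominantSolvabilityAnalysis
import Literature.NumberTheory.Transcendental.ExpDominantSolvabilityContraction
import Literature.NumberTheory.Transcendental.ExpDominantSolvabilityLogRatio
import Literature.NumberTheory.Transcendental.ExpDominantSolvabilityCover
import Literature.NumberTheory.Transcendental.ExpDominantSolvabilityAlgebra
import Mathlib.Analysis.SpecialFunctions.Complex.Arg
import HarnessLib

/-!
# Proof of Brownawell–Masser's Proposition 2 (exponential points, dominant additive projection)

This file discharges the named fact `Literature.NumberTheory.Transcendental.BrownawellMasser2017_dominantProjection` of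
`ExpDominantSolvability.lean` (W. D. Brownawell, D. W. Masser, *Zero estimates with moving
targets*, J. Lond. Math. Soc. (2) 95 (2017), Prop. 2 p. 448): an irreducible `W ⊆ ℂⁿ × ℂⁿ` of
dimension `n` whose torus part projects dominantly to `ℂⁿ` contains a point `(z, e^z)`.

The proof formalised here is D. Masser's Newton-approximation argument as published by
D'Aquino–Fornasiero–Terzo, *Generic solutions of equations with iterated exponentials*, Trans.
AMS 370 (2018), §2 (Thm 2.1, Thm 2.7, Cor. 2.9, Lemma 2.10), with two substitutions of tools
Mathlib lacks: Kantorovich's theorem (DFT Lemma 2.2) is replaced by a contraction argument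
(`ExpDominantSolvabilityContraction.lean`), and the leading-homogeneous-part asymptotics of
algebraic functions (DFT §2.1) by two-sided polynomial bounds plus the Borel–Carathéodory
inequality (`ExpDominantSolvabilityAnalysis.lean`, `ExpDominantSolvabilityLogRatio.lean`):

1. Algebra (`ExpDominantSolvabilityAlgebra.lean`): `W = Z(P)`, `P` prime with `P ∩ ℂ[x] = 0`;
   a primitive element gives `F ∈ ℂ[x][T]` monic, numerators `N`, a denominator `c`, a "bad"
   polynomial `g` and relations `pⱼ(x, yⱼ) = 0` on `W`, such that off `g = 0` every root `t` of
   `F(z, ·)` yields the point `(z, N(z, t)/c(z)) ∈ W`.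
2. A lattice direction `v ∈ (2πiℤ)ⁿ` generic for the leading forms of `g` and of the extreme
   coefficients of the `pⱼ` (DFT Lemma 2.3), so that for `t ∈ ℕ` large, on the ball
   `‖x - t v‖ ≤ ρ t`: `g ≠ 0`, and the roots `y` of `pⱼ(x, ·)` satisfy `|log ‖y‖| = O(log t)`.
3. On that ball a holomorphic root `τ(x)` of `F(x, ·)` exists (covering theory,
   `ExpDominantSolvabilityCover.lean`), whence holomorphic coordinates
   `yⱼ(x) = Nⱼ(x, τ(x))/c(x)` with `(x, y(x)) ∈ W`, zero-free, with `yⱼ(x)/yⱼ(tv) → 1` for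
   `‖x - tv‖ = O(log t)` (Borel–Carathéodory).
4. With `aⱼ = log yⱼ(tv)` (`= O(log t)`), solve `e^{ξⱼ} = yⱼ(tv + a + ξ)/yⱼ(tv)` by the
   contraction lemma; since `e^{t vⱼ} = 1`, `x = tv + a + ξ` satisfies `e^{xⱼ} = yⱼ(x)`, so
   `(x, e^x) ∈ W`.

## References

* W. D. Brownawell, D. W. Masser, *Zero estimates with moving targets*, J. Lond. Math. Soc. (2)
  95 (2017), 441–454, Prop. 2.
* P. D'Aquino, A. Fornasiero, G. Terzo, *Generic solutions of equations with iterated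
  exponentials*, Trans. Amer. Math. Soc. 370 (2018), 1393–1407, §2.
-/

noncomputable section

open MvPolynomial Metric Set Filter Topology

namespace Literature.NumberTheory.Transcendental

namespace ExpDominant

open HypersurfaceCover (spec)

variable {n : ℕ}

/-- Two-sided polynomial bounds give `|log ‖y‖| ≤ log K + N log t`. [folklore] -/
theorem abs_log_norm_le {K t : ℝ} {N : ℕ} (hK : 1 ≤ K) (ht : 1 ≤ t) {y : ℂ}
    (hlow : (K * t ^ N)⁻¹ ≤ ‖y‖) (hup : ‖y‖ ≤ K * t ^ N) :
    |Real.log ‖y‖| ≤ Real.log K + N * Real.log t := by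
  have hKt : 0 < K * t ^ N := by positivity
  have hy : 0 < ‖y‖ := lt_of_lt_of_le (inv_pos.mpr hKt) hlow
  have hlogKt : Real.log (K * t ^ N) = Real.log K + N * Real.log t := by
    rw [Real.log_mul (by positivity) (by positivity), Real.log_pow]
  rw [abs_le]
  constructor
  · have := Real.log_le_log (inv_pos.mpr hKt) hlow
    rw [Real.log_inv, hlogKt] at this
    linarith
  · have := Real.log_le_log hy hup
    rw [hlogKt] at this
    exact this

/-- Elementary bookkeeping for the choice of `t`: if `18 A² + 18 N² (log t)² < ε ρ t` then the
radius `r = A + N log t` is admissible. [folklore] -/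
theorem radius_admissible {A Nr ε ρ t : ℝ} (hA : Real.pi + 3 ≤ A) (hN : 0 ≤ Nr) (hε : 0 < ε) (hε1 : ε ≤ 1)
    (hρ : 0 < ρ) (ht : 1 ≤ t) (hlog : 0 ≤ Real.log t)
    (h : 18 * A ^ 2 + 18 * Nr ^ 2 * Real.log t ^ 2 < ε * ρ * t) :
    A + Nr * Real.log t < ρ * t ∧
      8 * (A + Nr * Real.log t - Real.pi - 2) * (A + Nr * Real.log t) /
        (ρ * t - (A + Nr * Real.log t)) ≤ ε := by
  set r := A + Nr * Real.log t with hr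
  have hr3 : 3 ≤ r := by
    have : 0 ≤ Nr * Real.log t := mul_nonneg hN hlog
    have := Real.pi_pos
    linarith
  have hr1 : 1 ≤ r := by linarith
  have hrsq : r ^ 2 ≤ 2 * A ^ 2 + 2 * (Nr * Real.log t) ^ 2 := by
    rw [hr]; nlinarith [sq_nonneg (A - Nr * Real.log t)]
  have h9 : 9 * r ^ 2 < ε * ρ * t := by nlinarith
  have hρt : ε * ρ * t ≤ ρ * t := by
    have : 0 ≤ ρ * t := by positivity
    nlinarith
  have hlt : r < ρ * t := by nlinarith
  refine ⟨hlt, ?_⟩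
  have hpos : 0 < ρ * t - r := by linarith
  rw [div_le_iff₀ hpos]
  have hM : A + Nr * Real.log t - Real.pi - 2 ≤ r := by rw [hr]; linarith [Real.pi_pos]
  have hM0 : 0 ≤ A + Nr * Real.log t - Real.pi - 2 := by
    have : 0 ≤ Nr * Real.log t := mul_nonneg hN hlog
    linarith
  nlinarith

/-- **The analytic core** (D'Aquino–Fornasiero–Terzo 2018, proof of Thm 2.7, on one sheet of
the variety as in Cor. 2.9): given the hypersurface model `(F, N, c, p)` of `W = Z(P)`, a point
`tv` with `e^{tvⱼ} = 1`, and a ball `B(tv, R)` on whose closure `F(z, ·)` is separable and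
`c ≠ 0`, and on which the roots of the `pⱼ(z, ·)` are non-zero with `|log ‖·‖| ≤ M`, where
`r = M + π + 2 < R` and `8 M r / (R - r) ≤ 1/(16(n+1))` — there is a point `(x, e^x) ∈ Z(P)`.
[cite: DaquinoFornasieroTerzo2017, Thm 2.7 and Cor. 2.9 (proofs)] -/
theorem exists_expPoint_near (P : Ideal (MvPolynomial (Fin n ⊕ Fin n) ℂ))
    {F : Polynomial (MvPolynomial (Fin n) ℂ)} (hFm : F.Monic) (hFdeg : 0 < F.natDegree)
    (N : Fin n → Polynomial (MvPolynomial (Fin n) ℂ)) (g c : MvPolynomial (Fin n) ℂ)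
    (p : Fin n → Polynomial (MvPolynomial (Fin n) ℂ))
    (hcg : ∀ z, eval z g ≠ 0 → eval z c ≠ 0)
    (hmem : ∀ (z : Fin n → ℂ) (t : ℂ), eval z g ≠ 0 → (spec F z).eval t = 0 →
      (Sum.elim z (fun j => (spec (N j) z).eval t / eval z c) : Fin n ⊕ Fin n → ℂ) ∈
        zeroLocus ℂ P)
    (hprel : ∀ j, ∀ w ∈ zeroLocus ℂ P,
      (spec (p j) (fun i => w (Sum.inl i))).eval (w (Sum.inr j)) = 0)
    (tv : Fin n → ℂ) (htv : ∀ j, Complex.exp (tv j) = 1) {R M : ℝ} (hM : 0 < M)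
    (hsep : ∀ z ∈ closedBall tv R, (spec F z).Separable)
    (hg : ∀ z ∈ closedBall tv R, eval z g ≠ 0)
    (hroots : ∀ z ∈ ball tv R, ∀ j, ∀ y : ℂ, (spec (p j) z).IsRoot y →
      y ≠ 0 ∧ |Real.log ‖y‖| ≤ M)
    (hRr : M + Real.pi + 2 < R)
    (hsmall : 8 * M * (M + Real.pi + 2) / (R - (M + Real.pi + 2)) ≤ 1 / (16 * (n + 1))) :
    ∃ x : Fin n → ℂ,
      (Sum.elim x (fun j => Complex.exp (x j)) : Fin n ⊕ Fin n → ℂ) ∈ zeroLocus ℂ P := by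
  set r := M + Real.pi + 2 with hr_def
  have hr : 0 < r := by have := Real.pi_pos; rw [hr_def]; linarith
  have hc : ∀ z ∈ closedBall tv R, eval z c ≠ 0 := fun z hz => hcg z (hg z hz)
  have hR : 0 < R := hr.trans hRr
  have hRr0 : 0 < R - r := by linarith
  have hε1 : (1 : ℝ) / (16 * (n + 1)) ≤ 1 := by
    rw [div_le_one (by positivity)]
    have : (0 : ℝ) ≤ n := Nat.cast_nonneg n
    linarith
  -- a holomorphic root of `F(z, ·)` over the ball
  obtain ⟨τ, hτd, hτF⟩ := exists_rootSection hFm hFdeg hR hsep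
  -- the coordinate functions `yⱼ(z) = Nⱼ(z, τ(z)) / c(z)`
  set y : Fin n → (Fin n → ℂ) → ℂ := fun j z => (spec (N j) z).eval (τ z) / eval z c with hy
  have hydiff : ∀ j, DifferentiableOn ℂ (y j) (ball tv R) := by
    intro j
    have heq : y j = fun z => (spec (N j) z).eval (τ z) * (eval z c)⁻¹ := by
      funext z; simp only [hy, div_eq_mul_inv]
    rw [heq]
    intro z hz
    have hτz : DifferentiableAt ℂ τ z := (hτd z hz).differentiableAt (isOpen_ball.mem_nhds hz)
    have h1 : DifferentiableAt ℂ (fun z => (spec (N j) z).eval (τ z)) z := by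
      have heq' : (fun z => (spec (N j) z).eval (τ z)) = fun z =>
          ∑ i ∈ Finset.range ((N j).natDegree + 1), eval z ((N j).coeff i) * τ z ^ i :=
        funext fun z => HypersurfaceCover.eval_spec_eq_sum (N j) z (τ z)
      rw [heq']
      refine DifferentiableAt.fun_sum fun i _ => ?_
      exact (DifferentiableAt.mvPolynomial_eval _ fun k =>
        (differentiableAt_pi.1 differentiableAt_id k)).mul (hτz.pow i)
    have h2 : DifferentiableAt ℂ (fun z => eval z c) z :=
      DifferentiableAt.mvPolynomial_eval _ fun k => (differentiableAt_pi.1 differentiableAt_id k)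
    have h3 : DifferentiableAt ℂ (fun z => (spec (N j) z).eval (τ z) * (eval z c)⁻¹) z :=
      h1.fun_mul (h2.fun_inv (hc z (ball_subset_closedBall hz)))
    exact h3.differentiableWithinAt
  -- points of `W`
  set wpt : (Fin n → ℂ) → (Fin n ⊕ Fin n → ℂ) := fun z => Sum.elim z (fun j => y j z) with hwpt
  have hwW : ∀ z ∈ ball tv R, wpt z ∈ zeroLocus ℂ P := fun z hz =>
    hmem z (τ z) (hg z (ball_subset_closedBall hz)) (hτF z hz)
  have hyroot : ∀ z ∈ ball tv R, ∀ j, (spec (p j) z).IsRoot (y j z) := fun z hz j => by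
    have := hprel j (wpt z) (hwW z hz)
    simpa [hwpt] using this
  have hy0 : ∀ j, ∀ z ∈ ball tv R, y j z ≠ 0 := fun j z hz =>
    (hroots z hz j _ (hyroot z hz j)).1
  have hylog : ∀ j, ∀ z ∈ ball tv R, |Real.log ‖y j z‖| ≤ M := fun j z hz =>
    (hroots z hz j _ (hyroot z hz j)).2
  have htv_mem : tv ∈ ball tv R := mem_ball_self hR
  -- the shift `aⱼ = log yⱼ(tv)`
  set a : Fin n → ℂ := fun j => Complex.log (y j tv) with ha
  have ha_norm : ‖a‖ ≤ M + Real.pi := by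
    rw [pi_norm_le_iff_of_nonneg (by positivity)]
    intro j
    calc ‖a j‖ ≤ |(a j).re| + |(a j).im| := Complex.norm_le_abs_re_add_abs_im _
      _ ≤ M + Real.pi := by
          refine add_le_add ?_ ?_
          · simp only [ha, Complex.log_re]
            exact hylog j tv htv_mem
          · simp only [ha, Complex.log_im]
            exact Complex.abs_arg_le_pi _
  -- slow variation on the small ball
  have hratio : ∀ j, ∀ x ∈ closedBall tv r, ‖y j x / y j tv - 1‖ ≤ 8 * M * r / (R - r) := by
    intro j x hx
    refine norm_div_sub_one_le hr hRr hM (hydiff j) (hy0 j) (hylog j) ?_ hx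
    have h1 : 8 * M * r / (R - r) ≤ 1 := hsmall.trans hε1
    have h2 : 4 * M * r / (R - r) ≤ 8 * M * r / (R - r) := by
      apply div_le_div_of_nonneg_right _ hRr0.le
      nlinarith [hM.le, hr.le]
    linarith
  -- the functions `g̃ⱼ(ξ) = yⱼ(tv + a + ξ)/yⱼ(tv) - 1` on the unit polydisc
  set gt : Fin n → (Fin n → ℂ) → ℂ := fun j ξ => y j (tv + a + ξ) / y j tv - 1 with hgt
  have hshift : ∀ ξ ∈ ball (0 : Fin n → ℂ) 1, tv + a + ξ ∈ closedBall tv r := by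
    intro ξ hξ
    rw [mem_ball, dist_zero_right] at hξ
    rw [mem_closedBall, dist_eq_norm, show tv + a + ξ - tv = a + ξ by abel]
    calc ‖a + ξ‖ ≤ ‖a‖ + ‖ξ‖ := norm_add_le _ _
      _ ≤ M + Real.pi + 1 := by linarith [hξ.le]
      _ ≤ r := by rw [hr_def]; linarith
  have hshift' : ∀ ξ ∈ ball (0 : Fin n → ℂ) 1, tv + a + ξ ∈ ball tv R := fun ξ hξ =>
    (closedBall_subset_ball hRr) (hshift ξ hξ)
  have hgt_diff : ∀ j, DifferentiableOn ℂ (gt j) (ball 0 1) := by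
    intro j
    have heq : gt j = fun ξ => y j (tv + a + ξ) * (y j tv)⁻¹ - 1 := by
      funext ξ; simp only [hgt, div_eq_mul_inv]
    rw [heq]
    intro ξ hξ
    have h1 : DifferentiableAt ℂ (fun ξ : Fin n → ℂ => tv + a + ξ) ξ :=
      differentiableAt_id.const_add _
    have h2 : DifferentiableAt ℂ (y j) (tv + a + ξ) :=
      (hydiff j).differentiableAt (isOpen_ball.mem_nhds (hshift' ξ hξ))
    have h3 : DifferentiableAt ℂ (fun ξ : Fin n → ℂ => y j (tv + a + ξ)) ξ := h2.comp ξ h1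
    have h4 : DifferentiableAt ℂ (fun ξ : Fin n → ℂ => y j (tv + a + ξ) * (y j tv)⁻¹ - 1) ξ :=
      (h3.mul_const _).sub_const 1
    exact h4.differentiableWithinAt
  have hgt_bound : ∀ j, ∀ ξ ∈ ball (0 : Fin n → ℂ) 1, ‖gt j ξ‖ ≤ 1 / (16 * (n + 1)) :=
    fun j ξ hξ => (hratio j _ (hshift ξ hξ)).trans hsmall
  obtain ⟨ξ, hξn, hξexp⟩ := exists_exp_eq_one_add gt (ε := 1 / (16 * (n + 1))) (by positivity)
    (le_of_eq (by field_simp)) hgt_diff hgt_bound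
  -- the exponential point
  set x : Fin n → ℂ := tv + a + ξ with hx
  refine ⟨x, ?_⟩
  have hξball : ξ ∈ ball (0 : Fin n → ℂ) 1 := by
    rw [mem_ball, dist_zero_right]; linarith
  have hxball : x ∈ ball tv R := hshift' ξ hξball
  have hexp : ∀ j, Complex.exp (x j) = y j x := by
    intro j
    have h1 := hξexp j
    have hgtj : 1 + gt j ξ = y j x / y j tv := by simp [hgt, hx]
    have hxj : x j = tv j + a j + ξ j := by simp [hx]
    rw [hxj, Complex.exp_add, Complex.exp_add, htv j, one_mul]
    have haj : Complex.exp (a j) = y j tv := by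
      simp only [ha]
      exact Complex.exp_log (hy0 j tv htv_mem)
    rw [haj, h1, hgtj, mul_div_cancel₀ _ (hy0 j tv htv_mem)]
  have hpt : (Sum.elim x (fun j => Complex.exp (x j)) : Fin n ⊕ Fin n → ℂ) = wpt x := by
    funext s
    rcases s with i | j
    · rfl
    · simp [hwpt, hexp j]
  rw [hpt]
  exact hwW x hxball

end ExpDominant

open ExpDominant HypersurfaceCover in
/-- **Brownawell–Masser 2017, Proposition 2** (p. 448), proved: an irreducible algebraic
subvariety `V = W ∩ (ℂⁿ × ℂˣⁿ)` of `ℂⁿ × ℂˣⁿ` of dimension `n` whose projection to the additive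
factor is dominant contains a point `(z₁, …, zₙ, e^{z₁}, …, e^{zₙ})`. Discharge of the named
fact `Literature.NumberTheory.Transcendental.BrownawellMasser2017_dominantProjection`, by Masser's Newton argument
as in D'Aquino–Fornasiero–Terzo 2018, §2 (see the module docstring).
[cite: BrownawellMasser2017, Prop. 2 (p. 448)] -/
theorem BrownawellMasser2017_dominantProjection_holds : BrownawellMasser2017_dominantProjection := by
  intro n W hW hdim hdom
  classical
  -- ### Step 0: `W = Z(P)` for the prime `P = I(W)`
  obtain ⟨⟨I, hWI⟩, hprime⟩ := hW
  haveI : (vanishingIdeal ℂ W).IsPrime := hprime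
  have hWP : W = zeroLocus ℂ (vanishingIdeal ℂ W) := by
    refine le_antisymm (zeroLocus_vanishingIdeal_le W) ?_
    rw [hWI]
    exact zeroLocus_anti_mono (le_vanishingIdeal_zeroLocus I)
  have hdimP : ringKrullDim (zeroLocusCoordRing (vanishingIdeal ℂ W)) = n := hdim
  have hdomP : ∀ q : MvPolynomial (Fin n) ℂ, rename Sum.inl q ∈ vanishingIdeal ℂ W → q = 0 := by
    intro q hq
    refine hdom q fun z hz => ?_
    have h := (mem_vanishingIdeal_iff.mp hq) z hz.1
    rwa [aeval_rename] at h
  have hneW : (W ∩ torusLocus ℂ n).Nonempty := hdom.nonempty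
  have hne : (zeroLocus ℂ (vanishingIdeal ℂ W) ∩ torusLocus ℂ n).Nonempty := hWP ▸ hneW
  have hY : ∀ j, (X (Sum.inr j) : MvPolynomial (Fin n ⊕ Fin n) ℂ) ∉ vanishingIdeal ℂ W :=
    X_inr_notMem_of_nonempty _ hne
  -- ### Step 1: the hypersurface model
  obtain ⟨F, g, N, c, p, hFm, hFdeg, hg0, hsep, hcne, hmem, hp0, hprel⟩ :=
    exists_model (vanishingIdeal ℂ W) hdimP hdomP hY
  -- ### Step 2: a generic lattice direction
  have hpne : ∀ j, p j ≠ 0 := fun j h => hp0 j (by rw [h, Polynomial.coeff_zero])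
  set topOf : MvPolynomial (Fin n) ℂ → MvPolynomial (Fin n) ℂ := fun a =>
    homogeneousComponent a.totalDegree a with htopOf
  set Q : MvPolynomial (Fin n) ℂ :=
    topOf g * ∏ j, (topOf ((p j).coeff 0) * topOf (p j).leadingCoeff) with hQ
  have hQ0 : Q ≠ 0 := by
    refine mul_ne_zero (homogeneousComponent_totalDegree_ne_zero hg0)
      (Finset.prod_ne_zero_iff.mpr fun j _ => mul_ne_zero ?_ ?_)
    · exact homogeneousComponent_totalDegree_ne_zero (hp0 j)
    · exact homogeneousComponent_totalDegree_ne_zero (Polynomial.leadingCoeff_ne_zero.mpr (hpne j))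
  obtain ⟨qv, hqv⟩ := exists_int_eval_ne_zero Q hQ0
  set v : Fin n → ℂ := fun i => 2 * Real.pi * Complex.I * (qv i : ℂ) with hv
  have hvQ : eval v Q ≠ 0 := hqv
  rw [hQ, map_mul, map_prod] at hvQ
  have hvg : eval v (topOf g) ≠ 0 := left_ne_zero_of_mul hvQ
  have hvprod := right_ne_zero_of_mul hvQ
  have hv0 : ∀ j, eval v (topOf ((p j).coeff 0)) ≠ 0 := fun j => by
    have := Finset.prod_ne_zero_iff.mp hvprod j (Finset.mem_univ j)
    rw [map_mul] at this
    exact left_ne_zero_of_mul this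
  have hvd : ∀ j, eval v (topOf (p j).leadingCoeff) ≠ 0 := fun j => by
    have := Finset.prod_ne_zero_iff.mp hvprod j (Finset.mem_univ j)
    rw [map_mul] at this
    exact right_ne_zero_of_mul this
  -- ### Step 3: uniform thresholds along the ray `t v`
  -- `g` as the constant polynomial `C g`
  obtain ⟨ρg, hρg, tg, htg, Kg, -, Ng, Hg⟩ :=
    exists_root_bounds (Polynomial.C g) v (by simpa [htopOf] using hvg) (by simpa [htopOf] using hvg)
  have HJ := fun j => exists_root_bounds (p j) v (hv0 j) (hvd j)
  choose ρJ hρJ tJ htJ KJ hKJ NJ HJ using HJ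
  set ρ : ℝ := min 1 ρg * ∏ j, min 1 (ρJ j) with hρ
  have hρpos : 0 < ρ := mul_pos (lt_min one_pos hρg) (Finset.prod_pos fun j _ => lt_min one_pos (hρJ j))
  have hprod_le_one : ∏ j, min 1 (ρJ j) ≤ 1 :=
    Finset.prod_le_one (fun j _ => (lt_min one_pos (hρJ j)).le) fun j _ => min_le_left _ _
  have hρg' : ρ ≤ ρg := by
    calc ρ ≤ min 1 ρg * 1 := by
          rw [hρ]; exact mul_le_mul_of_nonneg_left hprod_le_one (le_min zero_le_one hρg.le)
      _ ≤ ρg := by rw [mul_one]; exact min_le_right _ _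
  have hρJ' : ∀ j, ρ ≤ ρJ j := by
    intro j
    have h1 : ∏ j', min 1 (ρJ j') ≤ min 1 (ρJ j) := by
      rw [← Finset.mul_prod_erase Finset.univ (fun j' => min 1 (ρJ j')) (Finset.mem_univ j)]
      refine mul_le_of_le_one_right (le_min zero_le_one (hρJ j).le) ?_
      exact Finset.prod_le_one (fun j' _ => (lt_min one_pos (hρJ j')).le) fun j' _ => min_le_left _ _
    calc ρ ≤ 1 * min 1 (ρJ j) := by
          rw [hρ]
          exact mul_le_mul (min_le_left _ _) h1 (Finset.prod_nonneg fun j' _ =>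
            (lt_min one_pos (hρJ j')).le) zero_le_one
      _ ≤ ρJ j := by rw [one_mul]; exact min_le_right _ _
  set T₀ : ℝ := tg + ∑ j, tJ j with hT₀
  have hT₀g : tg ≤ T₀ := by
    rw [hT₀]; exact le_add_of_nonneg_right (Finset.sum_nonneg fun j _ => zero_le_one.trans (htJ j))
  have hT₀J : ∀ j, tJ j ≤ T₀ := fun j => by
    rw [hT₀]
    have h1 : tJ j ≤ ∑ j', tJ j' :=
      Finset.single_le_sum (fun j' _ => zero_le_one.trans (htJ j')) (Finset.mem_univ j)
    linarith [zero_le_one.trans htg]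
  have hT₀1 : 1 ≤ T₀ := htg.trans hT₀g
  set K : ℝ := 1 + ∑ j, KJ j with hK
  have hK1 : 1 ≤ K := by
    rw [hK]; exact le_add_of_nonneg_right (Finset.sum_nonneg fun j _ => zero_le_one.trans (hKJ j))
  have hKJ' : ∀ j, KJ j ≤ K := fun j => by
    rw [hK]
    have := Finset.single_le_sum (fun j' _ => zero_le_one.trans (hKJ j')) (Finset.mem_univ j)
    linarith
  set Nn : ℕ := ∑ j, NJ j with hNn
  have hNJ' : ∀ j, NJ j ≤ Nn := fun j =>
    Finset.single_le_sum (fun j' _ => Nat.zero_le _) (Finset.mem_univ j)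
  -- consequences for `t ≥ T₀` on the ball `‖x - t v‖ ≤ ρ t`
  have hgood : ∀ t : ℝ, T₀ ≤ t → ∀ x : Fin n → ℂ, ‖x - (t : ℂ) • v‖ ≤ ρ * t →
      eval x g ≠ 0 ∧ ∀ j (yy : ℂ), (spec (p j) x).IsRoot yy →
        yy ≠ 0 ∧ |Real.log ‖yy‖| ≤ Real.log K + Nn * Real.log t := by
    intro t ht x hx
    have ht1 : 1 ≤ t := hT₀1.trans ht
    have ht0 : 0 ≤ t := zero_le_one.trans ht1
    refine ⟨?_, fun j yy hyy => ?_⟩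
    · have := (Hg t (hT₀g.trans ht) x (hx.trans (mul_le_mul_of_nonneg_right hρg' ht0))).1.1
      simpa using this
    · obtain ⟨-, hb⟩ := HJ j t ((hT₀J j).trans ht) x (hx.trans (mul_le_mul_of_nonneg_right (hρJ' j) ht0))
      obtain ⟨hup, hlow⟩ := hb yy hyy
      have hmono : KJ j * t ^ NJ j ≤ K * t ^ Nn :=
        mul_le_mul (hKJ' j) (pow_le_pow_right₀ ht1 (hNJ' j)) (by positivity) (zero_le_one.trans hK1)
      have hup' : ‖yy‖ ≤ K * t ^ Nn := hup.trans hmono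
      have hlow' : (K * t ^ Nn)⁻¹ ≤ ‖yy‖ :=
        le_trans (inv_anti₀ (by have := hKJ j; positivity) hmono) hlow
      have hpos : 0 < ‖yy‖ := lt_of_lt_of_le (by positivity) hlow'
      exact ⟨norm_pos_iff.mp hpos, abs_log_norm_le hK1 ht1 hlow' hup'⟩
  -- ### Step 4: choice of `t ∈ ℕ`
  set ε : ℝ := 1 / (16 * (n + 1)) with hε
  have hεpos : 0 < ε := by positivity
  have hε1 : ε ≤ 1 := by
    rw [hε, div_le_one (by positivity)]
    have : (0 : ℝ) ≤ n := Nat.cast_nonneg n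
    linarith
  set A : ℝ := Real.log K + Real.pi + 3 with hA
  have hA3 : Real.pi + 3 ≤ A := by
    have := Real.log_nonneg hK1
    rw [hA]; linarith
  have hlim : Tendsto (fun t : ℝ => 18 * A ^ 2 * t⁻¹ + 18 * (Nn : ℝ) ^ 2 *
      (Real.log t ^ 2 / (1 * t + 0))) atTop (𝓝 0) := by
    have h1 : Tendsto (fun t : ℝ => 18 * A ^ 2 * t⁻¹) atTop (𝓝 0) := by
      have := tendsto_inv_atTop_zero.const_mul (18 * A ^ 2)
      rwa [mul_zero] at this
    have h2 : Tendsto (fun t : ℝ => 18 * (Nn : ℝ) ^ 2 * (Real.log t ^ 2 / (1 * t + 0))) atTop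
        (𝓝 0) := by
      simpa using (Real.tendsto_pow_log_div_mul_add_atTop 1 0 2 one_ne_zero).const_mul
        (18 * (Nn : ℝ) ^ 2)
    simpa using h1.add h2
  have hev : ∀ᶠ t : ℝ in atTop, 18 * A ^ 2 * t⁻¹ + 18 * (Nn : ℝ) ^ 2 *
      (Real.log t ^ 2 / (1 * t + 0)) < ε * ρ := hlim.eventually (gt_mem_nhds (by positivity))
  have hevN : ∀ᶠ m : ℕ in atTop, T₀ ≤ (m : ℝ) ∧ 18 * A ^ 2 * (m : ℝ)⁻¹ + 18 * (Nn : ℝ) ^ 2 *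
      (Real.log m ^ 2 / (1 * (m : ℝ) + 0)) < ε * ρ :=
    tendsto_natCast_atTop_atTop.eventually ((eventually_ge_atTop T₀).and hev)
  obtain ⟨m, hmT, hmε⟩ := hevN.exists
  set t : ℝ := (m : ℝ) with ht
  have ht1 : 1 ≤ t := hT₀1.trans hmT
  have htpos : 0 < t := by linarith
  have hlogt : 0 ≤ Real.log t := Real.log_nonneg ht1
  have hmain : 18 * A ^ 2 + 18 * (Nn : ℝ) ^ 2 * Real.log t ^ 2 < ε * ρ * t := by
    have h := mul_lt_mul_of_pos_right hmε htpos
    rw [one_mul, add_zero] at h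
    have e1 : (18 * A ^ 2 * t⁻¹ + 18 * (Nn : ℝ) ^ 2 * (Real.log t ^ 2 / t)) * t =
        18 * A ^ 2 + 18 * (Nn : ℝ) ^ 2 * Real.log t ^ 2 := by
      field_simp
    rw [e1] at h
    linarith
  obtain ⟨hrlt, hsmall⟩ := radius_admissible hA3 (Nat.cast_nonneg Nn) hεpos hε1 hρpos ht1 hlogt hmain
  -- the data for the analytic core
  set M : ℝ := Real.log K + Nn * Real.log t + 1 with hM
  have hM0 : 0 < M := by
    have := Real.log_nonneg hK1
    have : 0 ≤ (Nn : ℝ) * Real.log t := mul_nonneg (Nat.cast_nonneg _) hlogt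
    rw [hM]; linarith
  have hrM : A + Nn * Real.log t = M + Real.pi + 2 := by rw [hA, hM]; ring
  have hrM' : A + Nn * Real.log t - Real.pi - 2 = M := by rw [hA, hM]; ring
  rw [hrM', hrM] at hsmall
  rw [hrM] at hrlt
  set tv : Fin n → ℂ := (t : ℂ) • v with htv
  have htv1 : ∀ j, Complex.exp (tv j) = 1 := by
    intro j
    have : tv j = ((m * qv j : ℤ) : ℂ) * (2 * Real.pi * Complex.I) := by
      simp only [htv, hv, ht, Pi.smul_apply, smul_eq_mul]
      push_cast
      ring
    rw [this]
    exact Complex.exp_int_mul_two_pi_mul_I _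
  have hball_le : ∀ z ∈ closedBall tv (ρ * t), ‖z - (t : ℂ) • v‖ ≤ ρ * t := fun z hz => by
    rwa [mem_closedBall, dist_eq_norm] at hz
  have hsep' : ∀ z ∈ closedBall tv (ρ * t), (spec F z).Separable := fun z hz =>
    hsep z (hgood t hmT z (hball_le z hz)).1
  have hg' : ∀ z ∈ closedBall tv (ρ * t), eval z g ≠ 0 := fun z hz =>
    (hgood t hmT z (hball_le z hz)).1
  have hroots : ∀ z ∈ ball tv (ρ * t), ∀ j, ∀ yy : ℂ, (spec (p j) z).IsRoot yy →
      yy ≠ 0 ∧ |Real.log ‖yy‖| ≤ M := by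
    intro z hz j yy hyy
    obtain ⟨h1, h2⟩ := (hgood t hmT z (hball_le z (ball_subset_closedBall hz))).2 j yy hyy
    exact ⟨h1, h2.trans (by rw [hM]; linarith)⟩
  -- ### Step 5: the analytic core
  obtain ⟨x, hx⟩ := exists_expPoint_near (vanishingIdeal ℂ W) hFm hFdeg N g c p hcne hmem hprel
    tv htv1 hM0 hsep' hg' hroots hrlt hsmall
  refine ⟨Sum.elim x (fun j => Complex.exp (x j)), ?_, ?_⟩
  · rw [hWP]; exact hx
  · intro i; rfl

end Literature.NumberTheory.Transcendental
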